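import Summits.Parity.GeneralizedHardyLittlewood.Theorems.BeyondDiagonalBeatsQuarter.OffDiagBoxesNearFar
import Summits.Parity.GeneralizedHardyLittlewood.Theorems.BeyondDiagonalBeatsQuarter.OffDiagTailsMollified
import HarnessLib

/-!
# Route `PrimeLevelFamEdge`, crux K_B (stmt-Parity-20343), line `diagonal_kernel_split` rev 4, plan Ω,
# worker key W-b (ii), part 3 `OffDiagTailsMollifiedBoxes`: the FAR dyadic boxes of the mollified off-diagonal
# are `≤ ε·mainScaleReal` eventually — so the heart's OFF is a FINITE sum (moduli `r ≤ q⁷`, near boxes) up to `ε·ms`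

Assembly of W-b (i) (`OffDiagTailsMollified`: `r`-tail `≤ ε·ms` beyond `R = q⁷`) with W-b (ii) parts 1–2
(`OffDiagBoxes`, `OffDiagBoxesNearFar`: per layer piece `(d₁,d₂,r)` the far boxes total
`≤ 6144·G·e^{−√y₀/2}q̂³(lm)^{3/4}(d₁d₂)^{−5/4}·4πC q^{−1/2}r^{−29/20}`), in the mollified sum
`Σ_{l,m ≤ M} c_l c_m (…)`, `c_m = mollifierCoeff X² M m`, `|c_m| ≤ m^{−1/2}`:
* §1 `exists_norm_mollified_farBoxes_le`: `‖2q̂(2π/q)·Σ_{r≤R}Σ_{l,m≤M} c_l c_m Σ_{d₁∣l,d₂∣m} Σ_i 𝟙[FAR_{y₀} i]·box_i‖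
  ≤ K₃·e^{−√y₀/2}·q̂⁴q^{−3/2}M^{13/5}` for all primes `q`, `M > 1`, `R`, `y₀ > 0` (`K₃` absolute);
* §2 at `y₀ = (log q)⁴` (`e^{−(log q)²/2} ≤ q^{−6}` once `log q ≥ 12`) and `M = q̂^{Δ′}`, `0 < Δ′ ≤ 2`:
  **`offDiagMollified_farBoxes_le`** — `≤ ε·mainScaleReal Δ′ q` for all primes `q ≥ q₀(ε)` and EVERY `R`;
* §3 the decomposition **`offDiagMollified_eq_near_add_far_add_tail`** (identity, every `R`, `y₀`):
  `offDiagMollified Δ′ q = −re(NEAR) − re(FAR) − re(r-TAIL)`, `NEAR = 2q̂(2π/q)·Σ_{r≤R}Σ_{l,m}c_lc_mΣ_{d₁,d₂}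
  Σ_{i ∈ nearBoxes q d₁ d₂ y₀} box_i` a FINITE sum of dyadic boxes (each of which Ω-d5's `tsum_box_eq_tsum_dual`
  turns into its dual sum), and **`offDiagMollified_add_near_le`**: for every `ε > 0`, eventually in prime `q`,
  for all `0 < Δ′ ≤ 2` and `R ≥ q⁷`, `|offDiagMollified Δ′ q + re(NEAR at y₀ = (log q)⁴)| ≤ ε·mainScaleReal Δ′ q`.
This is W-b of the Ω SUB-LINE SPLIT: «the heart's OFF is a FINITE dual sum (r ≤ q^{A₀}, boxes ≤ q̂²L⁴) up to ε·ms».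
Absolute-value bookkeeping; nothing about the heart's truth. Helper (`--supports stmt-Parity-20343`); standard axioms.
«The programme SEARCHES and TYPES; no claim about Landau–Siegel zeros, Theorems 1–2 of arXiv:2211.02515 or
a repaired Margin232 until a kernel theorem says so.»
-/

noncomputable section

open Finset Polynomial
open scoped Real

namespace Summit.Parity.GeneralizedHardyLittlewood.Theorems.BeyondDiagonalBeatsQuarter.PeterssonSplit

open Literature.NumberTheory.LFunctions Literature.NumberTheory.LFunctions.KMV2000
open Literature.NumberTheory.LFunctions.KowalskiMichel2000 (petKloostermanTerm)
open Literature.Analysis.Calculus.WhitneyConvex (dyadicBump)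
open Summit.Parity.GeneralizedHardyLittlewood.Theorems.PrimeLevelFamEdgeIdeaDeltas.PeterssonLayers
  (sum_Icc_rpow_le)

variable {q : ℕ} [NeZero q]

/-! ### §1. The far boxes of the mollified off-diagonal, polynomially in `q`, exponentially small in `√y₀` -/

omit [NeZero q] in
/-- `Σ_{r ∈ [1,R]} r^{−29/20} ≤ Σ_{r ≥ 0} r^{−29/20}` (a finite absolute constant; the `r = 0` term is `0`).
[folklore] -/
theorem sum_Icc_rpow_le_tsum (R : ℕ) :
    ∑ r ∈ Icc 1 R, ((r : ℝ)) ^ (-(29 / 20 : ℝ)) ≤ ∑' r : ℕ, ((r : ℝ)) ^ (-(29 / 20 : ℝ)) :=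
  (Real.summable_nat_rpow.mpr (by norm_num)).sum_le_tsum _ fun _ _ ↦ by positivity

/-- **The far boxes of the mollified off-diagonal.** There is an absolute `K₃ ≥ 0` such that for all primes `q`,
all `M > 1`, all `R` and all `y₀ > 0`:
`‖2q̂(2π/q)·Σ_{r≤R} Σ_{l,m≤M} c_l c_m·Σ_{d₁∣l,d₂∣m} Σ_i 𝟙[4q̂²y₀ ≤ 2^{i₁+i₂}d₁d₂]·box_i‖ ≤ K₃·e^{−√y₀/2}·q̂⁴q^{−3/2}M^{13/5}`
(`c_m = mollifierCoeff X² M m`; `K₃ = 16π²·6144·(Σρ^j)²·(Σr^{−29/20})·C³`).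
[cite: KowalskiMichel2000, §2.4.2 p. 312 (23); KowalskiMichelVanderKam2000, (9) p. 7, (22) p. 12 — derivation] -/
theorem exists_norm_mollified_farBoxes_le :
    ∃ K₃ : ℝ, 0 ≤ K₃ ∧ ∀ (q : ℕ) [NeZero q], q.Prime → ∀ M : ℝ, 1 < M → ∀ R : ℕ, ∀ y₀ : ℝ, 0 < y₀ →
      ‖2 * (qhat q : ℂ) * (2 * π / q) *
          ∑ r ∈ Icc 1 R, ∑ l ∈ Icc 1 ⌊M⌋₊, ∑ m ∈ Icc 1 ⌊M⌋₊,
            ((mollifierCoeff (X ^ 2) M l * mollifierCoeff (X ^ 2) M m : ℝ) : ℂ) *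
              ∑ d₁ ∈ l.divisors, ∑ d₂ ∈ m.divisors, ∑' i : ℕ × ℕ,
                (if 4 * qhat q ^ 2 * y₀ ≤ 2 ^ (i.1 + i.2) * ((d₁ : ℝ) * d₂) then
                  ∑' k : ℕ × ℕ, ((dyadicBump ((k.1 : ℝ) / 2 ^ i.1) * dyadicBump ((k.2 : ℝ) / 2 ^ i.2) : ℝ) : ℂ) *
                    ((afeWeight q (d₁ * k.1, d₂ * k.2) : ℂ) *
                      petKloostermanTerm q (l / d₁ * k.1) (m / d₂ * k.2) r)
                  else 0)‖ ≤
        K₃ * Real.exp (-(Real.sqrt y₀ / 2)) * (qhat q ^ 4 * (q : ℝ) ^ (-(3 / 2 : ℝ)) * M ^ (13 / 5 : ℝ)) := by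
  obtain ⟨C, hC1, hC⟩ :=
    Literature.NumberTheory.Sieve.exists_card_divisors_le_mul_rpow' (by norm_num : (0 : ℝ) < 1 / 20)
  have hC0 : 0 ≤ C := zero_le_one.trans hC1
  set G : ℝ := (∑' j : ℕ, ((2 : ℝ) ^ (-(1 / 4 : ℝ))) ^ j) ^ 2 with hG
  have hG0 : 0 ≤ G := by positivity
  set Z : ℝ := ∑' r : ℕ, ((r : ℝ)) ^ (-(29 / 20 : ℝ)) with hZ
  have hZ0 : 0 ≤ Z := tsum_nonneg fun _ ↦ by positivity
  refine ⟨16 * π ^ 2 * 6144 * G * Z * C ^ 3, by positivity, fun q _ hq M hM R y₀ hy₀ ↦ ?_⟩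
  have hq1 : 1 ≤ q := hq.one_lt.le
  have hQ : 0 < qhat q := qhat_pos hq1
  have hq0 : (0 : ℝ) < q := by exact_mod_cast hq.pos
  have hM0 : 0 < M := by linarith
  set e : ℝ := Real.exp (-(Real.sqrt y₀ / 2)) with he
  -- the per-`(l,m,r)` bound
  set W : ℝ := 6144 * G * e * qhat q ^ 3 * (4 * π * C * (q : ℝ) ^ (-(1 / 2 : ℝ))) * C ^ 2 with hW
  have hW0 : 0 ≤ W := by positivity
  have hlm : ∀ r : ℕ, ∀ l ∈ Icc 1 ⌊M⌋₊, ∀ m ∈ Icc 1 ⌊M⌋₊,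
      ‖((mollifierCoeff (X ^ 2) M l * mollifierCoeff (X ^ 2) M m : ℝ) : ℂ) *
          ∑ d₁ ∈ l.divisors, ∑ d₂ ∈ m.divisors, ∑' i : ℕ × ℕ,
            (if 4 * qhat q ^ 2 * y₀ ≤ 2 ^ (i.1 + i.2) * ((d₁ : ℝ) * d₂) then
              ∑' k : ℕ × ℕ, ((dyadicBump ((k.1 : ℝ) / 2 ^ i.1) * dyadicBump ((k.2 : ℝ) / 2 ^ i.2) : ℝ) : ℂ) *
                ((afeWeight q (d₁ * k.1, d₂ * k.2) : ℂ) * petKloostermanTerm q (l / d₁ * k.1) (m / d₂ * k.2) r)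
              else 0)‖ ≤
        W * (r : ℝ) ^ (-(29 / 20 : ℝ)) * ((l : ℝ) ^ (3 / 10 : ℝ) * (m : ℝ) ^ (3 / 10 : ℝ)) := by
    intro r l hl m hm
    have hl1 := (Finset.mem_Icc.1 hl).1
    have hm1 := (Finset.mem_Icc.1 hm).1
    set Kr : ℝ := 4 * π * C * (q : ℝ) ^ (-(1 / 2 : ℝ)) * (r : ℝ) ^ (-(29 / 20 : ℝ)) with hKr
    have hKr0 : 0 ≤ Kr := by positivity
    -- each `(d₁,d₂)`: far total, then `(d₁d₂)^{-5/4} ≤ 1`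
    have hd : ∀ d₁ ∈ l.divisors, ∀ d₂ ∈ m.divisors,
        ‖∑' i : ℕ × ℕ, (if 4 * qhat q ^ 2 * y₀ ≤ 2 ^ (i.1 + i.2) * ((d₁ : ℝ) * d₂) then
            ∑' k : ℕ × ℕ, ((dyadicBump ((k.1 : ℝ) / 2 ^ i.1) * dyadicBump ((k.2 : ℝ) / 2 ^ i.2) : ℝ) : ℂ) *
              ((afeWeight q (d₁ * k.1, d₂ * k.2) : ℂ) * petKloostermanTerm q (l / d₁ * k.1) (m / d₂ * k.2) r)
            else 0)‖ ≤
          6144 * G * e * qhat q ^ 3 * ((l : ℝ) * m) ^ (3 / 4 : ℝ) * Kr := by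
      intro d₁ hd₁ d₂ hd₂
      have h := (norm_tsum_farBoxes_le hq hl1 hm1 hd₁ hd₂ hC r hy₀).2
      have hdd : ((d₁ : ℝ) * d₂) ^ (-(5 / 4 : ℝ)) ≤ 1 := by
        refine Real.rpow_le_one_of_one_le_of_nonpos ?_ (by norm_num)
        have h1 : (1 : ℝ) ≤ d₁ := by exact_mod_cast Nat.pos_of_mem_divisors hd₁
        have h2 : (1 : ℝ) ≤ d₂ := by exact_mod_cast Nat.pos_of_mem_divisors hd₂
        nlinarith
      calc _ ≤ 6144 * (∑' j : ℕ, ((2 : ℝ) ^ (-(1 / 4 : ℝ))) ^ j) ^ 2 * Real.exp (-(Real.sqrt y₀ / 2)) *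
            qhat q ^ 3 * ((l : ℝ) * m) ^ (3 / 4 : ℝ) * (((d₁ : ℝ) * d₂) ^ (-(5 / 4 : ℝ))) *
            (4 * π * C * (q : ℝ) ^ (-(1 / 2 : ℝ)) * (r : ℝ) ^ (-(29 / 20 : ℝ))) := h
        _ = 6144 * G * e * qhat q ^ 3 * ((l : ℝ) * m) ^ (3 / 4 : ℝ) * Kr * ((d₁ : ℝ) * d₂) ^ (-(5 / 4 : ℝ)) := by
            rw [hG, he, hKr]; ring
        _ ≤ 6144 * G * e * qhat q ^ 3 * ((l : ℝ) * m) ^ (3 / 4 : ℝ) * Kr * 1 :=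
            mul_le_mul_of_nonneg_left hdd (by positivity)
        _ = _ := mul_one _
    have hcoef := norm_coeffPair_mul_size_le abs_eval_X_sq_le_one hM hC hl hm
    rw [norm_mul]
    calc ‖((mollifierCoeff (X ^ 2) M l * mollifierCoeff (X ^ 2) M m : ℝ) : ℂ)‖ *
          ‖∑ d₁ ∈ l.divisors, ∑ d₂ ∈ m.divisors, ∑' i : ℕ × ℕ,
            (if 4 * qhat q ^ 2 * y₀ ≤ 2 ^ (i.1 + i.2) * ((d₁ : ℝ) * d₂) then
              ∑' k : ℕ × ℕ, ((dyadicBump ((k.1 : ℝ) / 2 ^ i.1) * dyadicBump ((k.2 : ℝ) / 2 ^ i.2) : ℝ) : ℂ) *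
                ((afeWeight q (d₁ * k.1, d₂ * k.2) : ℂ) * petKloostermanTerm q (l / d₁ * k.1) (m / d₂ * k.2) r)
              else 0)‖
        ≤ ‖((mollifierCoeff (X ^ 2) M l * mollifierCoeff (X ^ 2) M m : ℝ) : ℂ)‖ *
            ∑ d₁ ∈ l.divisors, ∑ d₂ ∈ m.divisors, 6144 * G * e * qhat q ^ 3 * ((l : ℝ) * m) ^ (3 / 4 : ℝ) * Kr :=
          mul_le_mul_of_nonneg_left ((norm_sum_le _ _).trans (Finset.sum_le_sum fun d₁ hd₁ ↦
            (norm_sum_le _ _).trans (Finset.sum_le_sum fun d₂ hd₂ ↦ hd d₁ hd₁ d₂ hd₂))) (norm_nonneg _)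
      _ = 6144 * G * e * qhat q ^ 3 * Kr * (‖((mollifierCoeff (X ^ 2) M l * mollifierCoeff (X ^ 2) M m : ℝ) : ℂ)‖ *
            (((l.divisors.card : ℝ) * (m.divisors.card : ℝ)) * ((l : ℝ) * m) ^ (3 / 4 : ℝ))) := by
          rw [Finset.sum_const, nsmul_eq_mul, Finset.sum_const, nsmul_eq_mul]; ring
      _ ≤ 6144 * G * e * qhat q ^ 3 * Kr * (1 ^ 2 * C ^ 2 * ((l : ℝ) ^ (3 / 10 : ℝ) * (m : ℝ) ^ (3 / 10 : ℝ))) :=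
          mul_le_mul_of_nonneg_left hcoef (by positivity)
      _ = _ := by rw [hW, hKr]; ring
  -- sum over `l, m`
  have hS : ∑ l ∈ Icc 1 ⌊M⌋₊, ((l : ℝ)) ^ (3 / 10 : ℝ) ≤ M ^ (13 / 10 : ℝ) := by
    have := sum_Icc_rpow_le hM.le (by norm_num : (0 : ℝ) ≤ 3 / 10)
    norm_num at this ⊢
    exact this
  have hS0 : 0 ≤ ∑ l ∈ Icc 1 ⌊M⌋₊, ((l : ℝ)) ^ (3 / 10 : ℝ) := Finset.sum_nonneg fun _ _ ↦ by positivity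
  have hr : ∀ r : ℕ, ‖∑ l ∈ Icc 1 ⌊M⌋₊, ∑ m ∈ Icc 1 ⌊M⌋₊,
      ((mollifierCoeff (X ^ 2) M l * mollifierCoeff (X ^ 2) M m : ℝ) : ℂ) *
        ∑ d₁ ∈ l.divisors, ∑ d₂ ∈ m.divisors, ∑' i : ℕ × ℕ,
          (if 4 * qhat q ^ 2 * y₀ ≤ 2 ^ (i.1 + i.2) * ((d₁ : ℝ) * d₂) then
            ∑' k : ℕ × ℕ, ((dyadicBump ((k.1 : ℝ) / 2 ^ i.1) * dyadicBump ((k.2 : ℝ) / 2 ^ i.2) : ℝ) : ℂ) *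
              ((afeWeight q (d₁ * k.1, d₂ * k.2) : ℂ) * petKloostermanTerm q (l / d₁ * k.1) (m / d₂ * k.2) r)
            else 0)‖ ≤ W * (r : ℝ) ^ (-(29 / 20 : ℝ)) * M ^ (13 / 5 : ℝ) := by
    intro r
    calc _ ≤ ∑ l ∈ Icc 1 ⌊M⌋₊, ∑ m ∈ Icc 1 ⌊M⌋₊,
          W * (r : ℝ) ^ (-(29 / 20 : ℝ)) * ((l : ℝ) ^ (3 / 10 : ℝ) * (m : ℝ) ^ (3 / 10 : ℝ)) :=
          (norm_sum_le _ _).trans (Finset.sum_le_sum fun l hl ↦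
            (norm_sum_le _ _).trans (Finset.sum_le_sum fun m hm ↦ hlm r l hl m hm))
      _ = W * (r : ℝ) ^ (-(29 / 20 : ℝ)) * ((∑ l ∈ Icc 1 ⌊M⌋₊, ((l : ℝ)) ^ (3 / 10 : ℝ)) *
            (∑ m ∈ Icc 1 ⌊M⌋₊, ((m : ℝ)) ^ (3 / 10 : ℝ))) := by
          rw [Finset.sum_mul_sum, Finset.mul_sum]
          refine Finset.sum_congr rfl fun l _ ↦ ?_
          rw [Finset.mul_sum]
      _ ≤ W * (r : ℝ) ^ (-(29 / 20 : ℝ)) * (M ^ (13 / 10 : ℝ) * M ^ (13 / 10 : ℝ)) := by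
          refine mul_le_mul_of_nonneg_left (mul_le_mul hS hS hS0 (by positivity)) (by positivity)
      _ = W * (r : ℝ) ^ (-(29 / 20 : ℝ)) * M ^ (13 / 5 : ℝ) := by
          rw [← Real.rpow_add hM0]; norm_num
  -- sum over `r`
  have hR : ‖∑ r ∈ Icc 1 R, ∑ l ∈ Icc 1 ⌊M⌋₊, ∑ m ∈ Icc 1 ⌊M⌋₊,
      ((mollifierCoeff (X ^ 2) M l * mollifierCoeff (X ^ 2) M m : ℝ) : ℂ) *
        ∑ d₁ ∈ l.divisors, ∑ d₂ ∈ m.divisors, ∑' i : ℕ × ℕ,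
          (if 4 * qhat q ^ 2 * y₀ ≤ 2 ^ (i.1 + i.2) * ((d₁ : ℝ) * d₂) then
            ∑' k : ℕ × ℕ, ((dyadicBump ((k.1 : ℝ) / 2 ^ i.1) * dyadicBump ((k.2 : ℝ) / 2 ^ i.2) : ℝ) : ℂ) *
              ((afeWeight q (d₁ * k.1, d₂ * k.2) : ℂ) * petKloostermanTerm q (l / d₁ * k.1) (m / d₂ * k.2) r)
            else 0)‖ ≤ W * Z * M ^ (13 / 5 : ℝ) := by
    calc _ ≤ ∑ r ∈ Icc 1 R, W * (r : ℝ) ^ (-(29 / 20 : ℝ)) * M ^ (13 / 5 : ℝ) :=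
          (norm_sum_le _ _).trans (Finset.sum_le_sum fun r _ ↦ hr r)
      _ = W * (∑ r ∈ Icc 1 R, ((r : ℝ)) ^ (-(29 / 20 : ℝ))) * M ^ (13 / 5 : ℝ) := by
          rw [Finset.mul_sum, Finset.sum_mul]
      _ ≤ W * Z * M ^ (13 / 5 : ℝ) := by
          refine mul_le_mul_of_nonneg_right (mul_le_mul_of_nonneg_left (sum_Icc_rpow_le_tsum R) hW0) ?_
          positivity
  -- the prefactor
  have hq32 : qhat q / q * (q : ℝ) ^ (-(1 / 2 : ℝ)) = qhat q * (q : ℝ) ^ (-(3 / 2 : ℝ)) := by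
    rw [div_eq_mul_inv, ← Real.rpow_neg_one, mul_assoc, ← Real.rpow_add hq0]
    norm_num
  rw [norm_mul, norm_prefactor hq1]
  calc 4 * π * qhat q / q * _ ≤ 4 * π * qhat q / q * (W * Z * M ^ (13 / 5 : ℝ)) :=
        mul_le_mul_of_nonneg_left hR (by positivity)
    _ = 16 * π ^ 2 * 6144 * G * Z * C ^ 3 * e * (qhat q ^ 3 * (qhat q / q * (q : ℝ) ^ (-(1 / 2 : ℝ))) *
          M ^ (13 / 5 : ℝ)) := by rw [hW]; ring
    _ = _ := by rw [hq32, he]; ring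

/-! ### §2. At `y₀ = (log q)⁴`: the far boxes are `≤ ε·mainScaleReal`, eventually -/

omit [NeZero q] in
/-- `e^{−(log q)²/2} ≤ q̂^{−6}` once `log q ≥ 12` (`(log q)²/2 ≥ 6 log q`, `q̂ ≤ q`). [folklore] -/
theorem exp_neg_log_sq_le (hq : 40 ≤ q) (hlog : 12 ≤ Real.log q) :
    Real.exp (-(Real.sqrt (Real.log q ^ 4) / 2)) ≤ qhat q ^ (-(6 : ℝ)) := by
  have hq1 : 1 ≤ q := le_trans (by norm_num) hq
  have hq0 : (0 : ℝ) < q := by exact_mod_cast (lt_of_lt_of_le (by norm_num : 0 < 40) hq)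
  have hQ : 0 < qhat q := qhat_pos hq1
  have hsqrt : Real.sqrt (Real.log q ^ 4) = Real.log q ^ 2 := by
    rw [show Real.log (q : ℝ) ^ 4 = (Real.log q ^ 2) ^ 2 by ring, Real.sqrt_sq (by positivity)]
  rw [hsqrt]
  calc Real.exp (-(Real.log q ^ 2 / 2)) ≤ Real.exp (Real.log q * (-(6 : ℝ))) :=
        Real.exp_le_exp.2 (by nlinarith)
    _ = (q : ℝ) ^ (-(6 : ℝ)) := by rw [Real.rpow_def_of_pos hq0]
    _ ≤ qhat q ^ (-(6 : ℝ)) := Real.rpow_le_rpow_of_nonpos hQ (qhat_le_self hq1) (by norm_num)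

/-- **W-b (ii): the FAR dyadic boxes of the mollified off-diagonal are `≤ ε·mainScaleReal`, eventually in `q`,
for EVERY truncation `R`.** For every `ε > 0` there is `q₀` such that for all primes `q ≥ q₀`, all `0 < Δ′ ≤ 2`
and all `R`: `‖2q̂(2π/q)·Σ_{r≤R}Σ_{l,m≤q̂^{Δ′}} c_l c_m Σ_{d₁∣l,d₂∣m} Σ_i 𝟙[4q̂²(log q)⁴ ≤ 2^{i₁+i₂}d₁d₂]·box_i‖
≤ ε·mainScaleReal Δ′ q` (`K₃e^{−(log q)²/2}q̂⁴q^{−3/2}(q̂^{Δ′})^{13/5} ≤ K₃q̂^{1/5}` once `log q ≥ 12`).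
[cite: KowalskiMichel2000, §2.4.2 p. 312 (23); KowalskiMichelVanderKam2000, (22) p. 12, §6 p. 19 — derivation] -/
theorem offDiagMollified_farBoxes_le {ε : ℝ} (hε : 0 < ε) :
    ∃ q₀ : ℕ, ∀ (q : ℕ) [NeZero q], q.Prime → q₀ ≤ q → ∀ Δ' : ℝ, 0 < Δ' → Δ' ≤ 2 → ∀ R : ℕ,
      ‖2 * (qhat q : ℂ) * (2 * π / q) *
          ∑ r ∈ Icc 1 R, ∑ l ∈ Icc 1 ⌊qhat q ^ Δ'⌋₊, ∑ m ∈ Icc 1 ⌊qhat q ^ Δ'⌋₊,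
            ((mollifierCoeff (X ^ 2) (qhat q ^ Δ') l * mollifierCoeff (X ^ 2) (qhat q ^ Δ') m : ℝ) : ℂ) *
              ∑ d₁ ∈ l.divisors, ∑ d₂ ∈ m.divisors, ∑' i : ℕ × ℕ,
                (if 4 * qhat q ^ 2 * Real.log q ^ 4 ≤ 2 ^ (i.1 + i.2) * ((d₁ : ℝ) * d₂) then
                  ∑' k : ℕ × ℕ, ((dyadicBump ((k.1 : ℝ) / 2 ^ i.1) * dyadicBump ((k.2 : ℝ) / 2 ^ i.2) : ℝ) : ℂ) *
                    ((afeWeight q (d₁ * k.1, d₂ * k.2) : ℂ) *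
                      petKloostermanTerm q (l / d₁ * k.1) (m / d₂ * k.2) r)
                  else 0)‖ ≤
        ε * mainScaleReal Δ' q := by
  obtain ⟨K₃, hK0, hK⟩ := exists_norm_mollified_farBoxes_le
  obtain ⟨q₁, hq₁⟩ := exists_qhat_rpow_le_mul_mainScaleReal hK0 hε
  obtain ⟨N, hN⟩ : ∃ N : ℕ, ∀ q : ℕ, N ≤ q → (12 : ℝ) ≤ Real.log q := by
    refine ⟨⌈Real.exp 12⌉₊, fun q hq ↦ ?_⟩
    have h : Real.exp 12 ≤ q := (Nat.le_ceil _).trans (by exact_mod_cast hq)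
    simpa using Real.log_le_log (Real.exp_pos 12) h
  refine ⟨max (max 40 q₁) N, fun q _ hq hq0 Δ' hΔ0 hΔ2 R ↦ ?_⟩
  have hq40 : 40 ≤ q := le_of_max_le_left (le_of_max_le_left hq0)
  have hqq₁ : q₁ ≤ q := le_of_max_le_right (le_of_max_le_left hq0)
  have hqN : N ≤ q := le_of_max_le_right hq0
  have hq1 : 1 ≤ q := hq.one_lt.le
  set s : ℝ := qhat q with hs
  have hs1 : 1 < s := one_lt_qhat hq40
  have hs0 : 0 < s := lt_trans one_pos hs1
  have hM : 1 < s ^ Δ' := Real.one_lt_rpow hs1 hΔ0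
  have hlog : 0 < Real.log q ^ 4 := by
    have := hN q hqN; positivity
  -- exponent bookkeeping: `e^{-(log q)^2/2} q̂⁴ q^{-3/2} (q̂^{Δ'})^{13/5} ≤ q̂^{3/5}`
  have hexp := exp_neg_log_sq_le hq40 (hN q hqN)
  have hsq : s ^ 2 ≤ (q : ℝ) := qhat_sq_le q
  have h2 : (q : ℝ) ^ (-(3 / 2 : ℝ)) ≤ s ^ (-(3 : ℝ)) := by
    calc (q : ℝ) ^ (-(3 / 2 : ℝ)) ≤ (s ^ 2) ^ (-(3 / 2 : ℝ)) :=
          Real.rpow_le_rpow_of_nonpos (by positivity) hsq (by norm_num)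
      _ = s ^ (-(3 : ℝ)) := by rw [← Real.rpow_natCast, ← Real.rpow_mul hs0.le]; norm_num
  have h3 : (s ^ Δ') ^ (13 / 5 : ℝ) ≤ s ^ (26 / 5 : ℝ) := by
    rw [← Real.rpow_mul hs0.le]
    exact Real.rpow_le_rpow_of_exponent_le hs1.le (by nlinarith)
  have hpoly : Real.exp (-(Real.sqrt (Real.log q ^ 4) / 2)) * (s ^ 4 * (q : ℝ) ^ (-(3 / 2 : ℝ)) *
      (s ^ Δ') ^ (13 / 5 : ℝ)) ≤ s ^ (3 / 5 : ℝ) := by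
    calc _ ≤ s ^ (-(6 : ℝ)) * (s ^ 4 * s ^ (-(3 : ℝ)) * s ^ (26 / 5 : ℝ)) := by gcongr
      _ = s ^ (1 / 5 : ℝ) := by
          rw [← Real.rpow_natCast s 4, ← Real.rpow_add hs0, ← Real.rpow_add hs0, ← Real.rpow_add hs0]
          norm_num
      _ ≤ s ^ (3 / 5 : ℝ) := Real.rpow_le_rpow_of_exponent_le hs1.le (by norm_num)
  calc _ ≤ K₃ * Real.exp (-(Real.sqrt (Real.log q ^ 4) / 2)) *
          (s ^ 4 * (q : ℝ) ^ (-(3 / 2 : ℝ)) * (s ^ Δ') ^ (13 / 5 : ℝ)) := hK q hq (s ^ Δ') hM R _ hlog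
    _ = K₃ * (Real.exp (-(Real.sqrt (Real.log q ^ 4) / 2)) *
          (s ^ 4 * (q : ℝ) ^ (-(3 / 2 : ℝ)) * (s ^ Δ') ^ (13 / 5 : ℝ))) := by ring
    _ ≤ K₃ * s ^ (3 / 5 : ℝ) := mul_le_mul_of_nonneg_left hpoly hK0
    _ ≤ ε * mainScaleReal Δ' q := hq₁ q hqq₁ Δ' hΔ0 hΔ2

/-! ### §3. The decomposition of the heart's off-diagonal: NEAR (finite) + FAR + `r`-TAIL -/

/-- **The decomposition (identity).** For `q` prime, every `Δ′`, every threshold `y₀` and every `R`: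
`offDiagMollified Δ′ q = −re(NEAR) − re(FAR) − re(TAIL)` with
`NEAR = 2q̂(2π/q)·Σ_{r≤R}Σ_{l,m≤q̂^{Δ′}}c_lc_m·Σ_{d₁∣l,d₂∣m}Σ_{i ∈ nearBoxes q d₁ d₂ y₀} box_i` (a FINITE sum),
`FAR` the same with `Σ_i 𝟙[4q̂²y₀ ≤ 2^{i₁+i₂}d₁d₂]·box_i`, `TAIL = 2q̂(2π/q)·Σ_{l,m}c_lc_m·Σ_{k≥0} offDiagLayer q l m (k+R+1)`
(`offDiagMollified_eq_head_add_tail` ∘ `offDiagLayer_eq_sum_divisors` ∘ `tsum_layerSummand_eq_near_add_far`).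
[cite: KowalskiMichelVanderKam2000, (21)–(23) p. 12 and Lemma 3.3 p. 9; KowalskiMichel2000, §2.4.2 p. 312 — derivation] -/
theorem offDiagMollified_eq_near_add_far_add_tail (hq : q.Prime) (Δ' y₀ : ℝ) (R : ℕ) :
    offDiagMollified Δ' q =
      -(2 * (qhat q : ℂ) * (2 * π / q) *
          ∑ r ∈ Icc 1 R, ∑ l ∈ Icc 1 ⌊qhat q ^ Δ'⌋₊, ∑ m ∈ Icc 1 ⌊qhat q ^ Δ'⌋₊,
            ((mollifierCoeff (X ^ 2) (qhat q ^ Δ') l * mollifierCoeff (X ^ 2) (qhat q ^ Δ') m : ℝ) : ℂ) *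
              ∑ d₁ ∈ l.divisors, ∑ d₂ ∈ m.divisors, ∑ i ∈ nearBoxes q d₁ d₂ y₀,
                ∑' k : ℕ × ℕ, ((dyadicBump ((k.1 : ℝ) / 2 ^ i.1) * dyadicBump ((k.2 : ℝ) / 2 ^ i.2) : ℝ) : ℂ) *
                  ((afeWeight q (d₁ * k.1, d₂ * k.2) : ℂ) *
                    petKloostermanTerm q (l / d₁ * k.1) (m / d₂ * k.2) r)).re -
      (2 * (qhat q : ℂ) * (2 * π / q) *
          ∑ r ∈ Icc 1 R, ∑ l ∈ Icc 1 ⌊qhat q ^ Δ'⌋₊, ∑ m ∈ Icc 1 ⌊qhat q ^ Δ'⌋₊,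
            ((mollifierCoeff (X ^ 2) (qhat q ^ Δ') l * mollifierCoeff (X ^ 2) (qhat q ^ Δ') m : ℝ) : ℂ) *
              ∑ d₁ ∈ l.divisors, ∑ d₂ ∈ m.divisors, ∑' i : ℕ × ℕ,
                (if 4 * qhat q ^ 2 * y₀ ≤ 2 ^ (i.1 + i.2) * ((d₁ : ℝ) * d₂) then
                  ∑' k : ℕ × ℕ, ((dyadicBump ((k.1 : ℝ) / 2 ^ i.1) * dyadicBump ((k.2 : ℝ) / 2 ^ i.2) : ℝ) : ℂ) *
                    ((afeWeight q (d₁ * k.1, d₂ * k.2) : ℂ) *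
                      petKloostermanTerm q (l / d₁ * k.1) (m / d₂ * k.2) r)
                  else 0)).re -
      (2 * (qhat q : ℂ) * (2 * π / q) *
          ∑ l ∈ Icc 1 ⌊qhat q ^ Δ'⌋₊, ∑ m ∈ Icc 1 ⌊qhat q ^ Δ'⌋₊,
            ((mollifierCoeff (X ^ 2) (qhat q ^ Δ') l * mollifierCoeff (X ^ 2) (qhat q ^ Δ') m : ℝ) : ℂ) *
              ∑' k : ℕ, offDiagLayer q l m (k + (R + 1))).re := by
  rw [offDiagMollified_eq_head_add_tail hq Δ' R]
  -- expand each layer of the head into near + far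
  have hlayer : ∀ r : ℕ, ∀ l ∈ Icc 1 ⌊qhat q ^ Δ'⌋₊, ∀ m ∈ Icc 1 ⌊qhat q ^ Δ'⌋₊,
      ((mollifierCoeff (X ^ 2) (qhat q ^ Δ') l * mollifierCoeff (X ^ 2) (qhat q ^ Δ') m : ℝ) : ℂ) *
          offDiagLayer q l m r =
        ((mollifierCoeff (X ^ 2) (qhat q ^ Δ') l * mollifierCoeff (X ^ 2) (qhat q ^ Δ') m : ℝ) : ℂ) *
            ∑ d₁ ∈ l.divisors, ∑ d₂ ∈ m.divisors, ∑ i ∈ nearBoxes q d₁ d₂ y₀,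
              ∑' k : ℕ × ℕ, ((dyadicBump ((k.1 : ℝ) / 2 ^ i.1) * dyadicBump ((k.2 : ℝ) / 2 ^ i.2) : ℝ) : ℂ) *
                ((afeWeight q (d₁ * k.1, d₂ * k.2) : ℂ) * petKloostermanTerm q (l / d₁ * k.1) (m / d₂ * k.2) r) +
          ((mollifierCoeff (X ^ 2) (qhat q ^ Δ') l * mollifierCoeff (X ^ 2) (qhat q ^ Δ') m : ℝ) : ℂ) *
            ∑ d₁ ∈ l.divisors, ∑ d₂ ∈ m.divisors, ∑' i : ℕ × ℕ,
              (if 4 * qhat q ^ 2 * y₀ ≤ 2 ^ (i.1 + i.2) * ((d₁ : ℝ) * d₂) then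
                ∑' k : ℕ × ℕ, ((dyadicBump ((k.1 : ℝ) / 2 ^ i.1) * dyadicBump ((k.2 : ℝ) / 2 ^ i.2) : ℝ) : ℂ) *
                  ((afeWeight q (d₁ * k.1, d₂ * k.2) : ℂ) * petKloostermanTerm q (l / d₁ * k.1) (m / d₂ * k.2) r)
                else 0) := by
    intro r l hl m hm
    have hl1 := (Finset.mem_Icc.1 hl).1
    have hm1 := (Finset.mem_Icc.1 hm).1
    rw [offDiagLayer_eq_sum_divisors hq hl1 hm1 r, ← mul_add, ← Finset.sum_add_distrib]
    congr 1
    refine Finset.sum_congr rfl fun d₁ hd₁ ↦ ?_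
    rw [← Finset.sum_add_distrib]
    exact Finset.sum_congr rfl fun d₂ hd₂ ↦ tsum_layerSummand_eq_near_add_far hq hl1 hm1 hd₁ hd₂ y₀ r
  rw [Finset.sum_congr rfl fun r _ ↦ Finset.sum_congr rfl fun l hl ↦ Finset.sum_congr rfl fun m hm ↦
    hlayer r l hl m hm]
  simp only [Finset.sum_add_distrib, mul_add, Complex.add_re]
  ring

/-- **W-b assembled: the heart's off-diagonal is a FINITE sum of near dyadic boxes over the moduli `r ≤ R`,
up to `ε·mainScaleReal`.** For every `ε > 0` there is `q₀` such that for all primes `q ≥ q₀`, all `0 < Δ′ ≤ 2`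
and all `R ≥ q⁷`: `|offDiagMollified Δ′ q + re(NEAR at y₀ = (log q)⁴)| ≤ ε·mainScaleReal Δ′ q` (W-b (i) for the
`r`-tail and W-b (ii) for the far boxes, each at `ε/2`). Each near box is dualised by Ω-d5
(`OffDiag.tsum_box_eq_tsum_dual`). [cite: KowalskiMichel2000, §2.4.2 p. 312 (23); KowalskiMichelVanderKam2000, (21)–(23) p. 12, §6 p. 19 — derivation] -/
theorem offDiagMollified_add_near_le {ε : ℝ} (hε : 0 < ε) :
    ∃ q₀ : ℕ, ∀ (q : ℕ) [NeZero q], q.Prime → q₀ ≤ q → ∀ Δ' : ℝ, 0 < Δ' → Δ' ≤ 2 → ∀ R : ℕ,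
      (q : ℝ) ^ 7 ≤ R →
        |offDiagMollified Δ' q +
            (2 * (qhat q : ℂ) * (2 * π / q) *
              ∑ r ∈ Icc 1 R, ∑ l ∈ Icc 1 ⌊qhat q ^ Δ'⌋₊, ∑ m ∈ Icc 1 ⌊qhat q ^ Δ'⌋₊,
                ((mollifierCoeff (X ^ 2) (qhat q ^ Δ') l * mollifierCoeff (X ^ 2) (qhat q ^ Δ') m : ℝ) : ℂ) *
                  ∑ d₁ ∈ l.divisors, ∑ d₂ ∈ m.divisors, ∑ i ∈ nearBoxes q d₁ d₂ (Real.log q ^ 4),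
                    ∑' k : ℕ × ℕ,
                      ((dyadicBump ((k.1 : ℝ) / 2 ^ i.1) * dyadicBump ((k.2 : ℝ) / 2 ^ i.2) : ℝ) : ℂ) *
                        ((afeWeight q (d₁ * k.1, d₂ * k.2) : ℂ) *
                          petKloostermanTerm q (l / d₁ * k.1) (m / d₂ * k.2) r)).re| ≤
          ε * mainScaleReal Δ' q := by
  have hε2 : 0 < ε / 2 := by positivity
  obtain ⟨q₁, hq₁⟩ := offDiagMollified_rTail_le hε2
  obtain ⟨q₂, hq₂⟩ := offDiagMollified_farBoxes_le hε2
  refine ⟨max q₁ q₂, fun q _ hq hq0 Δ' hΔ0 hΔ2 R hR ↦ ?_⟩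
  have h1 := hq₁ q hq (le_of_max_le_left hq0) Δ' hΔ0 hΔ2 R hR
  have h2 := hq₂ q hq (le_of_max_le_right hq0) Δ' hΔ0 hΔ2 R
  rw [offDiagMollified_eq_near_add_far_add_tail hq Δ' (Real.log q ^ 4) R]
  rw [show ∀ a b c : ℝ, -a - b - c + a = -(b + c) from fun a b c ↦ by ring, abs_neg]
  refine (abs_add_le _ _).trans ?_
  have h2' := (Complex.abs_re_le_norm _).trans h2
  linarith

end Summit.Parity.GeneralizedHardyLittlewood.Theorems.BeyondDiagonalBeatsQuarter.PeterssonSplit
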